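import Summits.BirchSwinnertonDyer.BirchSwinnertonDyer.Theorems.EisensteinPrimesTwoVariableDualDataExists
import HarnessLib

/-!
# The `Λ₂`-dual datum of `H¹_{nr}(K̃_∞, A)` is UNIQUE up to `Λ₂`-isomorphism
# (helper file 9 for crux 2 `GoodLatticeBDPValue`, stmt-BirchSwinnertonDyer-19032, cell `bsd-eis` seat `bsd-eis-k5-c2`)

Two-variable twin of the tree's `SelmerDualData.nonempty_linearEquiv_holds`
(`IwasawaSelmerDualUniquenessProofs`): the three axioms of `Rubin1991.DualData₂` (k5-ty p438535) —
`T₁` acts as `conj_{γ₁} − 1`, `T₂ = C X` as `conj_{γ₂} − 1`, constants `C (C c)` through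
`ℤ_p → ℤ/p^k` — FORCE the whole `Λ₂ = ℤ_p⟦T₂⟧⟦T₁⟧`-action, because every class of
`H¹_{nr}(K̃_∞, A)` is killed by a power of `p`, of `conj_{γ₁} − 1` and of `conj_{γ₂} − 1`
(`isLocNil_conjSel₂_sub_one`, file `…DualDataExists`, p448591) and the two conjugations commute
(`conjSel₂_comm`): peel off constant terms twice, `f = T₁ g + C f₀`, `f₀ = T₂ g₀ + C a`.

* `toDual_C_smul_eq`, `toDual_smul_eq` : for dual data `D, D'` and `x ∈ D.X`, `x' ∈ D'.X` with the
  same image in `Hom(H¹_{nr}, ℚ/ℤ)`, `f • x` and `f • x'` have the same image, for every `f ∈ Λ₂`;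
* `exists_linearEquiv₂` : **any two `DualData₂` for the same `(κ₁, κ₂, A, v̄, γ₁, γ₂)` have
  `Λ₂`-isomorphic modules**, compatibly with `toDual` — so the facts (iv)/(I2), stated for EVERY
  datum, and the datum of `dualData₂ExistsFor_holds` speak about one `Λ₂`-module.

HONEST FRAMING: generic; closes nothing by itself (consistency of the two-variable road's typing;
the comparison tool for the control map `D₂.X → D.X`). References: Greenberg LNM 1716 §1;
Washington §13.2; Rubin 1991 §4 p. 36.
-/

-- the summit namespace `Summit.BirchSwinnertonDyer.BirchSwinnertonDyer` repeats the problem name by design (D-0017)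
set_option linter.dupNamespace false
set_option autoImplicit false

noncomputable section

open scoped Classical

open NumberField IsDedekindDomain Field Literature.NumberTheory.GaloisRepresentations
  Literature.NumberTheory.EllipticCurves Literature.NumberTheory.EllipticCurves.GreenbergVatsal2000
  Literature.NumberTheory.EllipticCurves.KellerYin2024

namespace Summit.BirchSwinnertonDyer.BirchSwinnertonDyer.Theorems.IwasawaTwoVariable

universe u

section Unique

variable {K : Type u} [Field K] [NumberField K] {p : ℕ} [Fact p.Prime]
  {κ₁ κ₂ : ZpExtension K p}
  {M : Type u} [AddCommGroup M] [DistribMulAction (absoluteGaloisGroup K) M] [TopologicalSpace M]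
  [DiscreteTopology M] {vbar : HeightOneSpectrum (𝓞 K)} {γ₁ γ₂ : absoluteGaloisGroup K}
  (D D' : DualData₂ κ₁ κ₂ M vbar γ₁ γ₂)

/-- `(T₁ • x)(s) = x((conj_{γ₁} − 1) s)` — the first axiom, read with the endomorphism
`conjSel₂ γ₁ − 1`. [folklore] -/
theorem toDual_T₁_smul_eq (x : D.X) (s : unrSelmer₂ κ₁ κ₂ M vbar) :
    D.toDual ((PowerSeries.X : IwasawaAlgebra₂ p) • x) s =
      D.toDual x ((conjSel₂ κ₁ κ₂ M vbar γ₁ - 1) s) := by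
  rw [D.toDual_T₁_smul, IwasawaDual.End_sub_apply, AddMonoid.End.one_apply, map_sub]

/-- `(T₂ • x)(s) = x((conj_{γ₂} − 1) s)` — the second axiom, read with `conjSel₂ γ₂ − 1`.
[folklore] -/
theorem toDual_T₂_smul_eq (x : D.X) (s : unrSelmer₂ κ₁ κ₂ M vbar) :
    D.toDual ((PowerSeries.C (PowerSeries.X : IwasawaAlgebra p) : IwasawaAlgebra₂ p) • x) s =
      D.toDual x ((conjSel₂ κ₁ κ₂ M vbar γ₂ - 1) s) := by
  rw [D.toDual_T₂_smul, IwasawaDual.End_sub_apply, AddMonoid.End.one_apply, map_sub]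

/-- Inner peeling: on classes killed by `(conj_{γ₂} − 1)^N₂` (and by some power of `p`), the action of
a CONSTANT `C f₀`, `f₀ ∈ ℤ_p⟦T₂⟧`, read through `toDual`, is the same for `D` and `D'` on elements
with the same image (induction on `N₂`, `f₀ = T₂ g₀ + C a`). [folklore] -/
theorem toDual_C_smul_eq_of_pow_apply_eq_zero
    (htor : ∀ s : unrSelmer₂ κ₁ κ₂ M vbar, ∃ k : ℕ, p ^ k • s = 0) (N₂ : ℕ) :
    ∀ (s : unrSelmer₂ κ₁ κ₂ M vbar), ((conjSel₂ κ₁ κ₂ M vbar γ₂ - 1) ^ N₂) s = 0 →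
      ∀ (f₀ : IwasawaAlgebra p) (x : D.X) (x' : D'.X),
        (∀ t, D.toDual x t = D'.toDual x' t) →
        D.toDual ((PowerSeries.C f₀ : IwasawaAlgebra₂ p) • x) s =
          D'.toDual ((PowerSeries.C f₀ : IwasawaAlgebra₂ p) • x') s := by
  induction N₂ with
  | zero =>
    intro s hs f₀ x x' _
    rw [pow_zero, AddMonoid.End.one_apply] at hs
    rw [hs, map_zero, map_zero]
  | succ N ih =>
    intro s hs f₀ x x' hxx'
    obtain ⟨k, hk⟩ := htor s
    have hs' : ((conjSel₂ κ₁ κ₂ M vbar γ₂ - 1) ^ N) ((conjSel₂ κ₁ κ₂ M vbar γ₂ - 1) s) = 0 := by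
      rwa [pow_succ, AddMonoid.End.coe_mul, Function.comp_apply] at hs
    set g₀ : IwasawaAlgebra p := PowerSeries.mk fun n ↦ PowerSeries.coeff (n + 1) f₀
    set a : ℤ_[p] := PowerSeries.constantCoeff f₀
    have hf : f₀ = PowerSeries.X * g₀ + PowerSeries.C a := PowerSeries.eq_X_mul_shift_add_const f₀
    have key : ∀ (E : DualData₂ κ₁ κ₂ M vbar γ₁ γ₂) (y : E.X),
        E.toDual ((PowerSeries.C f₀ : IwasawaAlgebra₂ p) • y) s =
          E.toDual ((PowerSeries.C g₀ : IwasawaAlgebra₂ p) • y) ((conjSel₂ κ₁ κ₂ M vbar γ₂ - 1) s) +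
            (PadicInt.toZModPow k a).val • E.toDual y s := fun E y ↦ by
      conv_lhs => rw [hf]
      rw [map_add, map_mul, add_smul, mul_smul, map_add, AddMonoidHom.add_apply,
        toDual_T₂_smul_eq, E.toDual_C_smul a y s k hk]
    rw [key D x, key D' x', ih _ hs' g₀ x x' hxx', hxx' s]

/-- Outer peeling: on classes killed by `(conj_{γ₁} − 1)^N₁` and `(conj_{γ₂} − 1)^N₂`, the action of
ANY `f ∈ Λ₂` read through `toDual` is the same for `D` and `D'` on elements with the same image
(induction on `N₁`, `f = T₁ g + C f₀`, the two conjugations commuting). [folklore] -/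
theorem toDual_smul_eq_of_pow_apply_eq_zero
    (htor : ∀ s : unrSelmer₂ κ₁ κ₂ M vbar, ∃ k : ℕ, p ^ k • s = 0)
    (hc : conjSel₂ κ₁ κ₂ M vbar γ₁ * conjSel₂ κ₁ κ₂ M vbar γ₂ =
      conjSel₂ κ₁ κ₂ M vbar γ₂ * conjSel₂ κ₁ κ₂ M vbar γ₁) (N₁ : ℕ) :
    ∀ (N₂ : ℕ) (s : unrSelmer₂ κ₁ κ₂ M vbar), ((conjSel₂ κ₁ κ₂ M vbar γ₁ - 1) ^ N₁) s = 0 →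
      ((conjSel₂ κ₁ κ₂ M vbar γ₂ - 1) ^ N₂) s = 0 →
      ∀ (f : IwasawaAlgebra₂ p) (x : D.X) (x' : D'.X), (∀ t, D.toDual x t = D'.toDual x' t) →
        D.toDual (f • x) s = D'.toDual (f • x') s := by
  have hc' : (conjSel₂ κ₁ κ₂ M vbar γ₂ - 1) * (conjSel₂ κ₁ κ₂ M vbar γ₁ - 1) =
      (conjSel₂ κ₁ κ₂ M vbar γ₁ - 1) * (conjSel₂ κ₁ κ₂ M vbar γ₂ - 1) :=
    (Commute.sub_left (Commute.sub_right hc (Commute.one_right _)) (Commute.one_left _)).eq.symm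
  induction N₁ with
  | zero =>
    intro N₂ s hs _ f x x' _
    rw [pow_zero, AddMonoid.End.one_apply] at hs
    rw [hs, map_zero, map_zero]
  | succ N ih =>
    intro N₂ s hs₁ hs₂ f x x' hxx'
    have hs₁' : ((conjSel₂ κ₁ κ₂ M vbar γ₁ - 1) ^ N) ((conjSel₂ κ₁ κ₂ M vbar γ₁ - 1) s) = 0 := by
      rwa [pow_succ, AddMonoid.End.coe_mul, Function.comp_apply] at hs₁
    have hs₂' : ((conjSel₂ κ₁ κ₂ M vbar γ₂ - 1) ^ N₂) ((conjSel₂ κ₁ κ₂ M vbar γ₁ - 1) s) = 0 := by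
      have e : (conjSel₂ κ₁ κ₂ M vbar γ₂ - 1) ^ N₂ * (conjSel₂ κ₁ κ₂ M vbar γ₁ - 1) =
          (conjSel₂ κ₁ κ₂ M vbar γ₁ - 1) * (conjSel₂ κ₁ κ₂ M vbar γ₂ - 1) ^ N₂ :=
        (Commute.pow_left hc' N₂).eq
      have := congrArg (fun φ : AddMonoid.End (unrSelmer₂ κ₁ κ₂ M vbar) ↦ φ s) e
      simp only [AddMonoid.End.coe_mul, Function.comp_apply] at this
      rw [this, hs₂, map_zero]
    set g : IwasawaAlgebra₂ p := PowerSeries.mk fun n ↦ PowerSeries.coeff (n + 1) f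
    set f₀ : IwasawaAlgebra p := PowerSeries.constantCoeff f
    have hf : f = PowerSeries.X * g + PowerSeries.C f₀ := PowerSeries.eq_X_mul_shift_add_const f
    have key : ∀ (E : DualData₂ κ₁ κ₂ M vbar γ₁ γ₂) (y : E.X),
        E.toDual (f • y) s = E.toDual (g • y) ((conjSel₂ κ₁ κ₂ M vbar γ₁ - 1) s) +
          E.toDual ((PowerSeries.C f₀ : IwasawaAlgebra₂ p) • y) s := fun E y ↦ by
      conv_lhs => rw [hf]
      rw [add_smul, mul_smul, map_add, AddMonoidHom.add_apply, toDual_T₁_smul_eq]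
    rw [key D x, key D' x', ih N₂ _ hs₁' hs₂' g x x' hxx',
      toDual_C_smul_eq_of_pow_apply_eq_zero D D' htor N₂ s hs₂ f₀ x x' hxx']

/-- **The `Λ₂`-action of a `DualData₂` is forced**: for two dual data over a generator pair and a
`p`-primary `A` with open stabilisers, elements `x ∈ D.X`, `x' ∈ D'.X` with the same image in
`Hom(H¹_{nr}(K̃_∞, A), ℚ/ℤ)` have `f • x`, `f • x'` with the same image, for every `f ∈ Λ₂`.
[folklore] -/
theorem toDual_smul_eq (hγ : ZpExtension.IsTopGeneratorPair κ₁ κ₂ γ₁ γ₂)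
    (htor : ∀ m : M, ∃ k : ℕ, p ^ k • m = 0)
    (hstab : ∀ m : M,
      IsOpen (MulAction.stabilizer (absoluteGaloisGroup K) m : Set (absoluteGaloisGroup K)))
    {x : D.X} {x' : D'.X} (hxx' : ∀ t, D.toDual x t = D'.toDual x' t) (f : IwasawaAlgebra₂ p)
    (s : unrSelmer₂ κ₁ κ₂ M vbar) : D.toDual (f • x) s = D'.toDual (f • x') s := by
  have h₁ := isLocNil_conjSel₂_sub_one M vbar hγ htor hstab γ₁
  have h₂ := isLocNil_conjSel₂_sub_one M vbar hγ htor hstab γ₂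
  obtain ⟨N₁, hN₁⟩ := h₁.nil s
  obtain ⟨N₂, hN₂⟩ := h₂.nil s
  exact toDual_smul_eq_of_pow_apply_eq_zero D D' h₁.torsion
    (conjSel₂_comm (κ₁ := κ₁) (κ₂ := κ₂) M vbar γ₁ γ₂) N₁ N₂ s hN₁ hN₂ f x x' hxx'

/-- **Uniqueness of the `Λ₂`-dual datum** (two-variable twin of the tree's
`SelmerDualData.nonempty_linearEquiv_holds`): over a generator pair, for `A` `p`-primary with open
stabilisers, any two `DualData₂ κ₁ κ₂ A v̄ γ₁ γ₂` have `Λ₂`-ISOMORPHIC modules, the isomorphism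
`toDual'⁻¹ ∘ toDual` commuting with the identifications with `Hom(H¹_{nr}(K̃_∞, A), ℚ/ℤ)`.
[folklore] -/
theorem exists_linearEquiv₂ (hγ : ZpExtension.IsTopGeneratorPair κ₁ κ₂ γ₁ γ₂)
    (htor : ∀ m : M, ∃ k : ℕ, p ^ k • m = 0)
    (hstab : ∀ m : M,
      IsOpen (MulAction.stabilizer (absoluteGaloisGroup K) m : Set (absoluteGaloisGroup K))) :
    ∃ e : D.X ≃ₗ[IwasawaAlgebra₂ p] D'.X, ∀ x, D'.toDual (e x) = D.toDual x := by
  refine ⟨{ toFun := fun x ↦ (AddEquiv.ofBijective D'.toDual D'.bijective).symm (D.toDual x)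
            invFun := fun x' ↦ (AddEquiv.ofBijective D.toDual D.bijective).symm (D'.toDual x')
            map_add' := fun x y ↦ by rw [map_add, map_add]
            map_smul' := fun f x ↦ ?_
            left_inv := fun x ↦ ?_
            right_inv := fun x' ↦ ?_ }, fun x ↦ ?_⟩
  · apply D'.bijective.injective
    have e1 : D'.toDual ((AddEquiv.ofBijective D'.toDual D'.bijective).symm (D.toDual (f • x))) =
        D.toDual (f • x) :=
      (AddEquiv.ofBijective D'.toDual D'.bijective).apply_symm_apply _
    have e2 : D'.toDual ((AddEquiv.ofBijective D'.toDual D'.bijective).symm (D.toDual x)) =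
        D.toDual x :=
      (AddEquiv.ofBijective D'.toDual D'.bijective).apply_symm_apply _
    rw [RingHom.id_apply, e1]
    ext s
    exact toDual_smul_eq D D' hγ htor hstab (x' := _) (fun t ↦ by rw [e2]) f s
  · apply D.bijective.injective
    have e1 : D.toDual ((AddEquiv.ofBijective D.toDual D.bijective).symm
        (D'.toDual ((AddEquiv.ofBijective D'.toDual D'.bijective).symm (D.toDual x)))) =
        D'.toDual ((AddEquiv.ofBijective D'.toDual D'.bijective).symm (D.toDual x)) :=
      (AddEquiv.ofBijective D.toDual D.bijective).apply_symm_apply _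
    have e2 : D'.toDual ((AddEquiv.ofBijective D'.toDual D'.bijective).symm (D.toDual x)) =
        D.toDual x :=
      (AddEquiv.ofBijective D'.toDual D'.bijective).apply_symm_apply _
    exact e1.trans e2
  · apply D'.bijective.injective
    have e1 : D'.toDual ((AddEquiv.ofBijective D'.toDual D'.bijective).symm
        (D.toDual ((AddEquiv.ofBijective D.toDual D.bijective).symm (D'.toDual x')))) =
        D.toDual ((AddEquiv.ofBijective D.toDual D.bijective).symm (D'.toDual x')) :=
      (AddEquiv.ofBijective D'.toDual D'.bijective).apply_symm_apply _
    have e2 : D.toDual ((AddEquiv.ofBijective D.toDual D.bijective).symm (D'.toDual x')) =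
        D'.toDual x' :=
      (AddEquiv.ofBijective D.toDual D.bijective).apply_symm_apply _
    exact e1.trans e2
  · exact (AddEquiv.ofBijective D'.toDual D'.bijective).apply_symm_apply _

end Unique

end Summit.BirchSwinnertonDyer.BirchSwinnertonDyer.Theorems.IwasawaTwoVariable

end
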